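import Literature.Analysis.FluidPDE.GigaMiura2011BlowupAnalysis
import Literature.Analysis.FluidPDE.ClassicalBoundedWeak
import Literature.Analysis.FluidPDE.SpaceTimeMixedPartials
import Literature.Analysis.FluidPDE.EnergyToolkit
import Literature.Analysis.FluidPDE.TaoEnstrophyLocalisationProofs
import Literature.Analysis.FluidPDE.KNSSPlanarVorticity
import Literature.Analysis.Calculus.PoincareLemmaOneFormStarConvex
import HarnessLib

/-!
# Giga–Miura 2011, Lemma 2.3 (the planar vorticity Liouville theorem) — the named fact
# `gigaMiura2011_planar_vorticity_liouville` discharged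

Analysis/FluidPDE proof file (everything proved; no definitions, no named facts), sibling of
`GigaMiura2011BlowupAnalysis.lean`, discharging its named fact
`Literature.Analysis.FluidPDE.gigaMiura2011_planar_vorticity_liouville` (Y. Giga, H. Miura, *On
vorticity directions near singularities for the Navier–Stokes flows with infinite energy*, Comm.
Math. Phys. **303** (2011) 289–300 = Hokkaido Univ. Preprint **#956**, §2.1, **Lemma 2.3**, p. 8:
"Assume that `u = (u₁, u₂)` and `ω₃` are bounded smooth solution of (2.2)
[`ω₃ₜ − Δω₃ + (u, ∇)ω₃ = 0` in `ℝ² × (−∞, 0)`]. Assume that `curl u = ω` and `div u = 0`. Then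
`ω ≡ 0`."), in the rendering of the statement file: `u : ℝ → ℝ² → ℝ²` and `ω : ℝ → ℝ² → ℝ`
jointly smooth and bounded on `(−∞, 0) × ℝ²`, (2.2) pointwise, `curl2 (u t) = ω t`, `div u = 0`.

## The proof: Remark 2.5 (ii) made honest

Giga–Miura prove Lemma 2.3 (p. 9) by a blow-up/translation argument resting on the "`L^∞` theory
of the Navier–Stokes equations [GIM] or the vorticity equations [GGS]" (compactness needs interior
estimates for (2.2)), and note in Remark 2.5 (ii) that the statement "is already proved in [KNSS]
by using stability of the strong maximum principle" — KNSS 2009, **Theorem 5.1** (a bounded weak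
solution of the Navier–Stokes equations in `ℝ² × (−∞, 0)` is `b(t)`), which is a theorem of the
tree (`KNSS2009_liouville_planar_holds`, with the §4 regularity and Lemma 2.1 proved). This file
follows Remark 2.5 (ii): the only work is to see that the *velocity* `u` of a bounded smooth
solution `(u, ω)` of the VORTICITY formulation is a bounded weak solution of the Navier–Stokes
equations in KNSS's sense (`IsBoundedWeakNSSolutionOn`: `∫∫ ⟪u, ∂ₜψ + Δψ + (u·∇)ψ⟫ = 0` for
solenoidal space–time test fields `ψ`), i.e. to reconstruct the pressure:

1. *The momentum residual is irrotational.* `G = ∂ₜu + (u·∇)u − Δu` is smooth on the slab and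
   `curl2 G = ∂ₜω + (u·∇)ω + (div u) ω − Δω = 0` by (2.2) and `div u = 0`, using the planar
   identities `curl2 ∂ₜ = ∂ₜ curl2` (`curl2_timeDerivWithin`, mixed partials),
   `curl2 Δ = Δ curl2` (`curl2_laplacian`) and `curl2 ((u·∇)u) = (u·∇) curl2 u + (div u) curl2 u`
   (`curl2_convect_self`), the planar twins of the tree's `curl_timeDerivWithin`,
   `curl_laplacian`, `curl_convect_self` (Majda–Bertozzi, §1.1–§2.1).
2. *Irrotational smooth planar fields are gradients and annihilate solenoidal tests.* A `C¹`
   field with symmetric derivative on a finite-dimensional inner product space is the gradient of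
   its radial potential (the Poincaré lemma for `1`-forms, tree theorem
   `hasFDerivAt_radialIntegral_of_starConvex`, Spivak Thm. 4-11), hence `∫ ⟪G, φ⟫ = −∫ p div φ = 0`
   for every `φ ∈ C¹_c` with `div φ = 0` (`integral_inner_eq_zero_of_fderiv_symm_of_isDivFree`);
   in the plane, `curl2 G = 0` is the symmetry of `DG` (`inner_fderiv_comm_of_curl2_eq_zero`).
3. *Classical solutions of the forced system whose force annihilates solenoidal tests are bounded
   weak solutions* (`IsClassicalNSSolutionOn.isBoundedWeakNSSolutionOn_Iio_of_force_annihilates`,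
   the forced twin on `(−∞, T)` of the tree's `IsClassicalNSSolutionOn.isBoundedWeakNSSolutionOn`,
   Leray 1934 §III (17); KNSS 2009 §4 (ii)): `(u, p = 0, f = G)` is trivially a classical
   solution of the forced system, so `u` is a bounded weak solution on `ℝ² × (−∞, 0)`.
4. *KNSS Theorem 5.1* gives `u(t, ·) = b(t)` a.e. for a.e. `t`, everywhere by continuity, so
   `ω = curl2 u = 0`.

## Mathlib / tree search

Tree: `curl2`, `curl2CLM`, `curl2_const` (`KNSSRegularityPlanar`), `contDiff_curl2`, `curl2_sub`
(`KNSSPlanarVorticity`), `fderiv_fderiv_apply_eq` (`TaoEnstrophyLocalisationProofs`),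
`laplacian_eq_sum_fderiv_fderiv`, `integral_mul_divergence_add_eq_zero_right` (`WholeSpaceIBP`),
`IsSmoothSpaceTimeOn.timeDerivWithin_fderiv_slice_apply_of_uniqueDiffOn` (`SpaceTimeMixedPartials`),
`IsSmoothSpaceTimeOn.timeDerivWithin_clm_comp`, `.fderiv_slice` (`EnergyToolkit`,
`TaoEnstrophyLocalisation`), `IsClassicalNSSolutionOn.integral_inner_timeDerivWithin_test`,
`.isSmoothSpaceTimeOn_force`, `IsSpaceTimeTestOn.exists_time_support_lt` (`AncientMildWeak`),
`hasFDerivAt_radialIntegral_of_starConvex`, `contDiffOn_one_radialIntegral_of_starConvex`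
(`Calculus/PoincareLemmaOneFormStarConvex`), `KNSS2009_liouville_planar_holds`. Mathlib:
`isBoundedBilinearMap_inner`, `IsBoundedBilinearMap.toContinuousLinearMap`, `gradient`,
`derivWithin_of_isOpen`, `Measure.eqOn_open_of_ae_eq`.

## References

* Y. Giga, H. Miura, Comm. Math. Phys. 303 (2011) 289–300 = Hokkaido Univ. Preprint #956 (2010),
  §2.1, Lemma 2.3 and Remark 2.5 (ii) (preprint p. 8), proof of Lemma 2.3 (p. 9). [GigaMiura2011]
* G. Koch, N. Nadirashvili, G. Seregin, V. Šverák, Acta Math. 203 (2009) 83–105 =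
  arXiv:0709.3599: Thm 5.1 (p. 9), §4 (ii) (p. 8). [KochNadirashviliSereginSverak2009]
* M. Spivak, *Calculus on Manifolds* (1965), Thm. 4-11 (Poincaré lemma). [Spivak1965]
* A. J. Majda, A. L. Bertozzi, *Vorticity and Incompressible Flow* (CUP 2002), §1.1 (vector
  identities), §2.1 (the vorticity equation). [MajdaBertozziCUP2002]
* J. Leray, Acta Math. 63 (1934), §III (17) (classical solutions are weak solutions). [Leray1934]
-/

noncomputable section

open MeasureTheory Set Function Filter Topology TopologicalSpace InnerProductSpace
open scoped RealInnerProductSpace Laplacian ContDiff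

namespace Literature.Analysis.FluidPDE

/-! ### Step 2 (general part): closed `C¹` vector fields annihilate solenoidal test fields -/

section Closed

variable {E : Type*} [NormedAddCommGroup E] [InnerProductSpace ℝ E] [FiniteDimensional ℝ E]
  [MeasurableSpace E] [BorelSpace E]

/-- **A `C¹` vector field with symmetric derivative annihilates the divergence-free test
fields.** Let `F : E → E` be `C¹` on a finite-dimensional real inner product space with
`⟪DF(z)v, w⟫ = ⟪DF(z)w, v⟫` for all `z, v, w` (the `1`-form `⟪F, ·⟫` is closed). Then
`∫ ⟪F, φ⟫ = 0` for every `φ ∈ C¹_c(E; E)` with `div φ = 0`. Proof: by the Poincaré lemma for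
`1`-forms on the star-shaped set `E` (`hasFDerivAt_radialIntegral_of_starConvex`, Spivak 1965,
Thm. 4-11) the radial potential `p(y) = ∫₀¹ ⟪F(ty), y⟫ dt` is `C¹` with `∇p = F`, and
`∫ ⟪∇p, φ⟫ = −∫ p div φ = 0` (Leray 1934, §6 (1.11): no boundary terms on the whole space).
This is the half "irrotational ⇒ orthogonal to solenoidal tests" of de Rham's characterisation of
gradients, used by Giga–Miura to discard the pressure ("`p = (−Δ)⁻¹∇·(u ⊗ u)`", p. 3). [cite: Spivak1965, Thm. 4-11 (Poincaré lemma), with Leray1934 §6 (1.11)] -/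
theorem integral_inner_eq_zero_of_fderiv_symm_of_isDivFree {F : E → E} (hF : ContDiff ℝ 1 F)
    (hsymm : ∀ z v w : E, ⟪fderiv ℝ F z v, w⟫ = ⟪fderiv ℝ F z w, v⟫)
    {φ : E → E} (hφ : ContDiff ℝ 1 φ) (hφc : HasCompactSupport φ)
    (hdiv : VectorCalculus.IsDivFree φ) :
    ∫ x, ⟪F x, φ x⟫ = 0 := by
  -- the closed `1`-form `A = ⟪F, ·⟫`
  set B : E →L[ℝ] E →L[ℝ] ℝ :=
    (isBoundedBilinearMap_inner (𝕜 := ℝ) (E := E)).toContinuousLinearMap with hB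
  have hBapp : ∀ x y : E, B x y = ⟪x, y⟫ := fun x y => rfl
  set A : E → E →L[ℝ] ℝ := fun z => B (F z) with hA
  have hA1 : ContDiff ℝ 1 A := B.contDiff.comp hF
  have hFd : Differentiable ℝ F := hF.differentiable one_ne_zero
  have hDA : ∀ z v : E, fderiv ℝ A z v = B (fderiv ℝ F z v) := by
    intro z v
    have h : HasFDerivAt A (B.comp (fderiv ℝ F z)) z := B.hasFDerivAt.comp z (hFd z).hasFDerivAt
    rw [h.fderiv, ContinuousLinearMap.comp_apply]
  have hsymmA : ∀ z ∈ (univ : Set E), ∀ v w : E, fderiv ℝ A z v w = fderiv ℝ A z w v := by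
    intro z _ v w
    rw [hDA, hDA, hBapp, hBapp]
    exact hsymm z v w
  -- its radial potential `P`, `DP = A`, i.e. `∇P = F`
  set P : E → ℝ := fun y => ∫ t in (0 : ℝ)..1, A ((0 : E) + t • (y - 0)) (y - 0) with hP
  have hPd : ∀ z : E, HasFDerivAt P (A z) z := fun z =>
    Literature.Analysis.Calculus.hasFDerivAt_radialIntegral_of_starConvex isOpen_univ
      (starConvex_univ (0 : E)) hA1.contDiffOn hsymmA (mem_univ z)
  have hP1 : ContDiff ℝ 1 P := contDiffOn_univ.1
    (Literature.Analysis.Calculus.contDiffOn_one_radialIntegral_of_starConvex isOpen_univ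
      (starConvex_univ (0 : E)) hA1.contDiffOn hsymmA)
  have hgrad : ∀ z : E, gradient P z = F z := by
    intro z
    have h1 : fderiv ℝ P z = A z := (hPd z).fderiv
    rw [gradient, h1]
    apply (InnerProductSpace.toDual ℝ E).injective
    rw [LinearIsometryEquiv.apply_symm_apply]
    ext w
    rw [InnerProductSpace.toDual_apply_apply]
    exact (hBapp (F z) w).symm
  -- no boundary terms: `∫ P div φ + ∫ ⟪φ, ∇P⟫ = 0`
  have key := integral_mul_divergence_add_eq_zero_right hP1 hφ hφc
  have h0 : (fun x => P x * VectorCalculus.divergence φ x) = fun _ => (0 : ℝ) :=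
    funext fun x => by rw [hdiv x, mul_zero]
  have h2 : (fun x => ⟪φ x, gradient P x⟫) = fun x => ⟪F x, φ x⟫ :=
    funext fun x => by rw [hgrad, real_inner_comm]
  rw [h0, h2, integral_zero, zero_add] at key
  exact key

end Closed

/-! ### Step 3 (general part): forced classical solutions whose force annihilates solenoidal
tests are bounded weak solutions -/

section ForcedWeak

variable {E : Type*} [NormedAddCommGroup E] [InnerProductSpace ℝ E] [FiniteDimensional ℝ E]
  [MeasurableSpace E] [BorelSpace E]

/-- **Classical solutions of the forced system on `E × (−∞, T)` whose force annihilates the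
solenoidal tests are bounded weak solutions in the sense of KNSS.** Let `(u, p)` be a classical
solution of `∂ₜu + (u·∇)u = νΔu − ∇p + f`, `div u = 0` on `(−∞, T) × E` with `u` bounded there,
and suppose `∫ ⟪f(t), φ⟫ = 0` for every `t < T` and every smooth compactly supported
divergence-free `φ` (e.g. `f = ∇q`). Then `u` is a bounded weak solution on `(−∞, T)`
(`IsBoundedWeakNSSolutionOn`, KNSS 2009 §4 (ii): `div u = 0` and
`∫∫ u·(∂ₜψ + νΔψ) + u_k u·∂_k ψ = 0` for solenoidal space–time tests `ψ`). Proof as for the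
unforced twin `IsClassicalNSSolutionOn.isBoundedWeakNSSolutionOn` (Leray 1934, §III (17)): the
time support of `ψ` lies in `[a, b]`, `b < T`; on `[a − 1, (b + T)/2]` the slice identity
`∫⟪∂ₜu, ψ⟫ = ∫⟪u, (u·∇)ψ⟫ + ν∫⟪u, Δψ⟫ + ∫⟪f, ψ⟫` (`integral_inner_timeDerivWithin_test`) loses
its last term by hypothesis and turns the integrand into `d/dt ∫⟪u, ψ⟫`, whose time integral
vanishes. [cite: KochNadirashviliSereginSverak2009, §4 (ii) (arXiv:0709.3599 p. 8); Leray1934 §III (17)] -/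
theorem IsClassicalNSSolutionOn.isBoundedWeakNSSolutionOn_Iio_of_force_annihilates {T ν : ℝ}
    {f u : ℝ → E → E} {p : ℝ → E → ℝ} (h : IsClassicalNSSolutionOn (Iio T) ν f u p)
    (hbdd : IsBoundedOn (Iio T) u)
    (hf : ∀ t < T, ∀ φ : E → E, ContDiff ℝ (⊤ : ℕ∞) φ → HasCompactSupport φ →
      VectorCalculus.IsDivFree φ → ∫ x, ⟪f t x, φ x⟫ = 0) :
    IsBoundedWeakNSSolutionOn (Iio T) isOpen_Iio ν u := by
  -- adapted from `IsClassicalNSSolutionOn.isBoundedWeakNSSolutionOn` (`ClassicalBoundedWeak`)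
  have hu_cont : ContinuousOn (uncurry u) (Iio T ×ˢ univ) := h.smooth_velocity.continuousOn
  refine ⟨?_, hbdd, ?_, ?_⟩
  · exact hu_cont.aestronglyMeasurable (measurableSet_Iio.prod MeasurableSet.univ)
  · exact (ae_restrict_iff' measurableSet_Iio).2 (Eventually.of_forall fun t ht =>
      VectorCalculus.IsDivFree.isWeaklyDivFree_holds (h.divFree t ht)
        (contDiff_infty.1 (h.contDiff_velocity ht) 1))
  intro ψ hψ hdiv
  -- time support `[a', b'] ⊂ (−∞, T)` and a compact interval `[a₁, b₁]` around it
  obtain ⟨a', b', ha'b', hb'T, hsupp⟩ := hψ.exists_time_support_lt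
  set a₁ : ℝ := a' - 1 with ha₁
  set b₁ : ℝ := (b' + T) / 2 with hb₁
  have ha₁a' : a₁ < a' := by rw [ha₁]; linarith
  have hb'b₁ : b' < b₁ := by rw [hb₁]; linarith
  have hb₁T : b₁ < T := by rw [hb₁]; linarith
  have ha₁b₁ : a₁ < b₁ := by linarith
  have hsub : Icc a₁ b₁ ⊆ Iio T := fun t ht => lt_of_le_of_lt ht.2 hb₁T
  set S₀ : Set ℝ := Icc a₁ b₁ with hS₀
  have hU : UniqueDiffOn ℝ S₀ := uniqueDiffOn_Icc ha₁b₁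
  have h₀ : IsClassicalNSSolutionOn S₀ ν f u p := h.mono hsub hU
  have hu₀ : ContinuousOn (uncurry u) (S₀ ×ˢ univ) := h₀.smooth_velocity.continuousOn
  have hdt_cont : ContinuousOn (uncurry (timeDerivWithin S₀ u)) (S₀ ×ˢ univ) :=
    (h₀.smooth_velocity.timeDerivWithin hU).continuousOn
  -- values of `ψ` and its derived fields off the time support
  have hψ0 : ∀ t, t ∉ Icc a' b' → ∀ x, ψ t x = 0 := fun t ht x => by rw [hsupp t ht]; rfl
  have hψa₁ : ∀ x, ψ a₁ x = 0 := hψ0 a₁ fun ht => (not_le.2 ha₁a') ht.1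
  have hψb₁ : ∀ x, ψ b₁ x = 0 := hψ0 b₁ fun ht => (not_le.2 hb'b₁) ht.2
  have hzero : ∀ t, t ∉ Icc a' b' → ∀ x,
      ⟪u t x, timeDeriv ψ t x⟫ + ⟪u t x, convect (u t) (ψ t) x⟫ + ν * ⟪u t x, Δ (ψ t) x⟫ = 0 := by
    intro t ht x
    have hopen : IsOpen (Icc a' b')ᶜ := isClosed_Icc.isOpen_compl
    have hnear : (fun s => ψ s x) =ᶠ[𝓝 t] fun _ => (0 : E) :=
      Filter.eventually_of_mem (hopen.mem_nhds ht) fun s hs => hψ0 s hs x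
    have h1 : timeDeriv ψ t x = 0 := by
      rw [timeDeriv_apply, hnear.deriv_eq, deriv_const]
    have h2 : fderiv ℝ (ψ t) x = 0 := by
      rw [show ψ t = fun _ => (0 : E) from funext (hψ0 t ht), fderiv_fun_const, Pi.zero_apply]
    have h3 : Δ (ψ t) x = 0 :=
      laplacian_eq_zero_of_notMem_tsupport (by
        rw [hsupp t ht, tsupport_eq_empty_iff.2 rfl]; exact notMem_empty x)
    rw [h1, convect_apply, h2, h3]
    simp
  -- reduce the time integral to `(a₁, b₁)`
  rw [setIntegral_eq_of_subset_of_forall_sdiff_eq_zero (measurableSet_Iio (a := T))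
    (fun t ht => lt_trans ht.2 hb₁T : Ioo a₁ b₁ ⊆ Iio T)]
  swap
  · intro t ht
    have ht' : t ∉ Icc a' b' := fun h' => ht.2 ⟨ha₁a'.trans_le h'.1, h'.2.trans_lt hb'b₁⟩
    simp only [hzero t ht', integral_zero]
  -- the compact `x`-shadow of the test field
  obtain ⟨K, hK, hKt⟩ := hψ.exists_compact_slice_subset
  have hψK : ∀ t, ∀ x ∉ K, ψ t x = 0 := fun t x hx =>
    image_eq_zero_of_notMem_tsupport fun h' => hx (hKt t h')
  -- the space–time integrand `∂ₜ ⟪u, ψ⟫`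
  set D : ℝ × E → ℝ := fun z => ⟪u z.1 z.2, timeDeriv ψ z.1 z.2⟫ +
    ⟪timeDerivWithin S₀ u z.1 z.2, ψ z.1 z.2⟫ with hD
  have hDcont : ContinuousOn D (Icc a₁ b₁ ×ˢ univ) := by
    refine ContinuousOn.add (ContinuousOn.inner hu₀ hψ.continuous_timeDeriv.continuousOn)
      (ContinuousOn.inner hdt_cont ?_)
    exact hψ.contDiff.continuous.continuousOn
  have hDK : ∀ t ∈ Icc a₁ b₁, ∀ x ∉ K, D (t, x) = 0 := fun t _ x hx => by
    simp only [hD]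
    rw [hψK t x hx, timeDeriv_eq_zero_of_forall (fun s => hψK s x hx)]
    simp
  have hDint := integrable_prod_of_continuousOn hK hDcont hDK
  -- slice identity for every `t ∈ (a₁, b₁)`; the force term vanishes
  have hslice : ∀ t ∈ Ioo a₁ b₁, ∫ x, (⟪u t x, timeDeriv ψ t x⟫ + ⟪u t x, convect (u t) (ψ t) x⟫ +
      ν * ⟪u t x, (Δ (ψ t)) x⟫) = ∫ x, D (t, x) := by
    intro t ht
    have ht' : t ∈ S₀ := Ioo_subset_Icc_self ht
    have htT : t < T := hsub ht'
    have hψ2 : ContDiff ℝ 2 (ψ t) := contDiff_infty.1 (hψ.contDiff_slice t) 2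
    have key := h₀.integral_inner_timeDerivWithin_test hU ht' hψ2 (hψ.hasCompactSupport_slice t)
      (hdiv t)
    have hF0 : ∫ x, ⟪f t x, ψ t x⟫ = 0 :=
      hf t htT (ψ t) (hψ.contDiff_slice t) (hψ.hasCompactSupport_slice t) (hdiv t)
    have huc : Continuous (u t) := (h₀.contDiff_velocity ht').continuous
    have i1 : Integrable (fun x => ⟪u t x, timeDeriv ψ t x⟫) (volume : Measure E) :=
      integrable_inner_of_hasCompactSupport_right huc
        (hψ.continuous_timeDeriv.comp (Continuous.prodMk_right t))
        (HasCompactSupport.intro hK fun x hx => timeDeriv_eq_zero_of_forall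
          (fun s => hψK s x hx) t)
    have i2 : Integrable (fun x => ⟪timeDerivWithin S₀ u t x, ψ t x⟫) (volume : Measure E) :=
      integrable_inner_of_hasCompactSupport_right
        (((h₀.smooth_velocity.timeDerivWithin hU).contDiff_slice ht').continuous)
        (hψ.contDiff_slice t).continuous (hψ.hasCompactSupport_slice t)
    have hψ1 : ContDiff ℝ 1 (ψ t) := hψ2.of_le one_le_two
    have iC' : Integrable (fun x => ⟪u t x, convect (u t) (ψ t) x⟫) (volume : Measure E) :=
      integrable_inner_of_hasCompactSupport_right huc
        ((hψ1.continuous_fderiv one_ne_zero).clm_apply huc)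
        (((hψ.hasCompactSupport_slice t).fderiv (𝕜 := ℝ)).mono fun x hx => by
          contrapose! hx; simp only [mem_support, not_not] at hx; simp [convect, hx])
    have iL' : Integrable (fun x => ν * ⟪u t x, (Δ (ψ t)) x⟫) (volume : Measure E) :=
      (integrable_inner_of_hasCompactSupport_right huc (continuous_laplacian hψ2)
        ((hψ.hasCompactSupport_slice t).mono' fun x hx => by
          contrapose! hx; simp [laplacian_eq_zero_of_notMem_tsupport hx])).const_mul ν
    have iF : Integrable (fun x => ⟪f t x, ψ t x⟫) (volume : Measure E) :=
      integrable_inner_of_hasCompactSupport_right (h₀.continuous_force_slice hU ht')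
        (hψ.contDiff_slice t).continuous (hψ.hasCompactSupport_slice t)
    have i3 : Integrable (fun x => ⟪u t x, convect (u t) (ψ t) x⟫ + ν * ⟪u t x, (Δ (ψ t)) x⟫)
        (volume : Measure E) := iC'.add iL'
    have key' : ∫ x, ⟪timeDerivWithin S₀ u t x, ψ t x⟫ =
        ∫ x, (⟪u t x, convect (u t) (ψ t) x⟫ + ν * ⟪u t x, (Δ (ψ t)) x⟫) := by
      rw [key, integral_add i3 iF, hF0, add_zero]
    calc ∫ x, (⟪u t x, timeDeriv ψ t x⟫ + ⟪u t x, convect (u t) (ψ t) x⟫ +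
          ν * ⟪u t x, (Δ (ψ t)) x⟫)
        = ∫ x, (⟪u t x, timeDeriv ψ t x⟫ + (⟪u t x, convect (u t) (ψ t) x⟫ +
          ν * ⟪u t x, (Δ (ψ t)) x⟫)) :=
          integral_congr_ae (Eventually.of_forall fun x => by ring)
      _ = (∫ x, ⟪u t x, timeDeriv ψ t x⟫) + ∫ x, ⟪timeDerivWithin S₀ u t x, ψ t x⟫ := by
          rw [integral_add i1 i3, key']
      _ = ∫ x, D (t, x) := (integral_add i1 i2).symm
  -- integrate the slice identity in time and swap the integrals
  have hstep : ∫ t in Ioo a₁ b₁, ∫ x, (⟪u t x, timeDeriv ψ t x⟫ + ⟪u t x, convect (u t) (ψ t) x⟫ +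
      ν * ⟪u t x, (Δ (ψ t)) x⟫) = ∫ x, ∫ t in Ioo a₁ b₁, D (t, x) := by
    rw [setIntegral_congr_fun measurableSet_Ioo hslice]
    exact integral_integral_swap (f := fun t x => D (t, x)) hDint
  -- fundamental theorem of calculus on each time line: both boundary terms vanish
  have hline : ∀ x, ∫ t in Ioo a₁ b₁, D (t, x) = 0 := by
    intro x
    have hcont : ContinuousOn (fun t => ⟪u t x, ψ t x⟫) (Icc a₁ b₁) := by
      refine ContinuousOn.inner ?_ ?_
      · exact hu₀.comp (Continuous.prodMk_left x).continuousOn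
          fun t ht => mk_mem_prod ht (mem_univ x)
      · exact (hψ.contDiff.continuous.comp (Continuous.prodMk_left x)).continuousOn
    have hderiv : ∀ t ∈ Ioo a₁ b₁, HasDerivWithinAt (fun t => ⟪u t x, ψ t x⟫) (D (t, x))
        (Ioi t) t := by
      intro t ht
      have hu' : HasDerivAt (fun s => u s x) (timeDerivWithin S₀ u t x) t :=
        (h₀.smooth_velocity.hasDerivWithinAt_timeDerivWithin hU (Ioo_subset_Icc_self ht)
          x).hasDerivAt (Icc_mem_nhds ht.1 ht.2)
      exact (hu'.inner ℝ (hψ.hasDerivAt_time t x)).hasDerivWithinAt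
    have hint : IntervalIntegrable (fun t => D (t, x)) volume a₁ b₁ := by
      refine ContinuousOn.intervalIntegrable ?_
      rw [uIcc_of_le ha₁b₁.le]
      exact hDcont.comp (Continuous.prodMk_left x).continuousOn
        fun t ht => mk_mem_prod ht (mem_univ x)
    have := intervalIntegral.integral_eq_sub_of_hasDeriv_right_of_le ha₁b₁.le hcont hderiv hint
    rw [intervalIntegral.integral_of_le ha₁b₁.le, integral_Ioc_eq_integral_Ioo] at this
    rw [this, hψa₁ x, hψb₁ x, inner_zero_right, inner_zero_right, sub_self]
  rw [hstep, integral_congr_ae (Eventually.of_forall hline), integral_zero]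

end ForcedWeak

/-! ### Step 1: planar vorticity calculus (`curl2` of `∂ₜu`, `Δu`, `(u·∇)u`) -/

section Curl2

/-- `curl2 w x = curl2CLM (Dw(x))` (definitional). [folklore] -/
private theorem curl2_eq_curl2CLM (w : EuclideanSpace ℝ (Fin 2) → EuclideanSpace ℝ (Fin 2))
    (x : EuclideanSpace ℝ (Fin 2)) : curl2 w x = curl2CLM (fderiv ℝ w x) := rfl

/-- Chain rule: `D(curl2 v)(x) = curl2CLM ∘ D(Dv)(x)` for `v ∈ C²`. [folklore] -/
private theorem fderiv_curl2 {v : EuclideanSpace ℝ (Fin 2) → EuclideanSpace ℝ (Fin 2)}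
    (hv : ContDiff ℝ 2 v) (x : EuclideanSpace ℝ (Fin 2)) :
    fderiv ℝ (curl2 v) x = curl2CLM.comp (fderiv ℝ (fderiv ℝ v) x) := by
  -- adapted from `fderiv_curl` (`TaoEnstrophyLocalisation`)
  rw [curl2_eq_comp]
  have hd : DifferentiableAt ℝ (fderiv ℝ v) x :=
    ((hv.fderiv_right (m := 1) (by norm_num)).differentiable one_ne_zero).differentiableAt
  exact (curl2CLM.hasFDerivAt.comp x hd.hasFDerivAt).fderiv

/-- `curl2 (∂ₑ v) = ∂ₑ (curl2 v)` for `v ∈ C²` (Schwarz). [folklore] -/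
private theorem curl2_fderiv_apply {v : EuclideanSpace ℝ (Fin 2) → EuclideanSpace ℝ (Fin 2)}
    (hv : ContDiff ℝ 2 v) (x e : EuclideanSpace ℝ (Fin 2)) :
    curl2 (fun y => fderiv ℝ v y e) x = fderiv ℝ (curl2 v) x e := by
  -- adapted from `curl_fderiv_apply` (`TaoEnstrophyLocalisationProofs`)
  rw [curl2_eq_curl2CLM, fderiv_fderiv_apply_eq hv, fderiv_curl2 hv]
  rfl

/-- **`curl2 (Δ v) = Δ (curl2 v)`** for `v ∈ C³(ℝ²; ℝ²)` (constant-coefficient operators commute;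
Majda–Bertozzi §2.1, `curl (νΔv) = νΔω`; planar twin of the tree's `curl_laplacian`). [folklore] -/
private theorem curl2_laplacian {v : EuclideanSpace ℝ (Fin 2) → EuclideanSpace ℝ (Fin 2)}
    (hv : ContDiff ℝ 3 v) (x : EuclideanSpace ℝ (Fin 2)) :
    curl2 (Δ v) x = (Δ (curl2 v)) x := by
  -- adapted from `curl_laplacian` (`VorticityCalculus`)
  set b := stdOrthonormalBasis ℝ (EuclideanSpace ℝ (Fin 2))
  have hv2 : ContDiff ℝ 2 v := hv.of_le (by norm_cast)
  have hd1 : ∀ e, ContDiff ℝ 2 fun y => fderiv ℝ v y e := fun e =>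
    (hv.fderiv_right (m := 2) (by norm_cast)).clm_apply contDiff_const
  have hd2 : ∀ e e', ContDiff ℝ 1 fun y => fderiv ℝ (fun z => fderiv ℝ v z e) y e' := fun e e' =>
    ((hd1 e).fderiv_right (m := 1) (by norm_cast)).clm_apply contDiff_const
  have hc2 : ContDiff ℝ 2 (curl2 v) := contDiff_curl2 (n := 2) (by exact_mod_cast hv)
  -- right-hand side
  have hR : (Δ (curl2 v)) x =
      ∑ i, curl2 (fun y => fderiv ℝ (fun z => fderiv ℝ v z (b i)) y (b i)) x := by
    rw [laplacian_eq_sum_fderiv_fderiv b hc2]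
    refine Finset.sum_congr rfl fun i _ => ?_
    have h1 : (fun y => fderiv ℝ (curl2 v) y (b i)) = curl2 fun z => fderiv ℝ v z (b i) :=
      funext fun y => (curl2_fderiv_apply hv2 y (b i)).symm
    rw [h1, ← curl2_fderiv_apply (hd1 (b i)) x (b i)]
  -- left-hand side
  have hL : curl2 (Δ v) x =
      ∑ i, curl2 (fun y => fderiv ℝ (fun z => fderiv ℝ v z (b i)) y (b i)) x := by
    have hΔ : Δ v = fun y => ∑ i, fderiv ℝ (fun z => fderiv ℝ v z (b i)) y (b i) :=
      funext fun y => laplacian_eq_sum_fderiv_fderiv b hv2 y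
    rw [curl2_eq_curl2CLM, hΔ,
      fderiv_fun_sum fun i _ => (hd2 (b i) (b i)).differentiable one_ne_zero x, map_sum]
    rfl
  rw [hL, hR]

/-- Expansion of a linear map in the standard coordinates of `ℝ²`: `(L v)ᵢ = ∑ₘ vₘ (L eₘ)ᵢ`. [folklore] -/
private theorem clm_apply_coord2 (L : EuclideanSpace ℝ (Fin 2) →L[ℝ] EuclideanSpace ℝ (Fin 2))
    (v : EuclideanSpace ℝ (Fin 2)) (i : Fin 2) :
    L v i = ∑ m, v m * L (EuclideanSpace.single m (1 : ℝ)) i := by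
  -- adapted from `clm_apply_coord` (`VorticityStretching`)
  have hv : v = ∑ m, v m • EuclideanSpace.single m (1 : ℝ) := by
    simpa using ((EuclideanSpace.basisFun (Fin 2) ℝ).sum_repr v).symm
  conv_lhs => rw [hv]
  simp [map_smul]

/-- The trace of a linear map of `ℝ²` in standard coordinates: `tr L = ∑ₘ (L eₘ)ₘ`. [folklore] -/
private theorem trace_eq_sum_coord2
    (L : EuclideanSpace ℝ (Fin 2) →L[ℝ] EuclideanSpace ℝ (Fin 2)) :
    LinearMap.trace ℝ (EuclideanSpace ℝ (Fin 2)) (L : EuclideanSpace ℝ (Fin 2) →ₗ[ℝ]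
      EuclideanSpace ℝ (Fin 2)) = ∑ m, L (EuclideanSpace.single m (1 : ℝ)) m := by
  -- adapted from `trace_eq_sum_coord` (`VorticityStretching`)
  rw [LinearMap.trace_eq_sum_inner _ (EuclideanSpace.basisFun (Fin 2) ℝ)]
  simp [EuclideanSpace.basisFun_apply, EuclideanSpace.inner_single_left]

/-- The `2 × 2` matrix identity `curl2 (L ∘ L) = (tr L) · curl2 L` (for `L = [[a, b], [c, d]]`:
`(L²)₁₀ − (L²)₀₁ = (a + d)(c − b)`). [folklore] -/
private theorem curl2CLM_comp_self
    (L : EuclideanSpace ℝ (Fin 2) →L[ℝ] EuclideanSpace ℝ (Fin 2)) :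
    curl2CLM (L.comp L) = LinearMap.trace ℝ (EuclideanSpace ℝ (Fin 2))
      (L : EuclideanSpace ℝ (Fin 2) →ₗ[ℝ] EuclideanSpace ℝ (Fin 2)) * curl2CLM L := by
  have hc : ∀ v : EuclideanSpace ℝ (Fin 2), ∀ k : Fin 2,
      L (L v) k = ∑ m, (L v) m * L (EuclideanSpace.single m (1 : ℝ)) k :=
    fun v k => clm_apply_coord2 L (L v) k
  rw [trace_eq_sum_coord2]
  simp only [curl2CLM_apply, ContinuousLinearMap.coe_comp, Function.comp_apply, hc,
    Fin.sum_univ_two]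
  ring

/-- **`curl2 ((u·∇)u) = (u·∇)(curl2 u) + (div u) curl2 u`** pointwise for `u ∈ C²(ℝ²; ℝ²)` (the
planar form of Majda–Bertozzi's `curl ((u·∇)u) = (u·∇)ω − (ω·∇)u + (div u)ω`, §1.1: in the plane
the stretching term is absent; planar twin of the tree's `curl_convect_self`). [folklore] -/
private theorem curl2_convect_self {u : EuclideanSpace ℝ (Fin 2) → EuclideanSpace ℝ (Fin 2)}
    (hu : ContDiff ℝ 2 u) (x : EuclideanSpace ℝ (Fin 2)) :
    curl2 (convect u u) x =
      fderiv ℝ (curl2 u) x (u x) + VectorCalculus.divergence u x * curl2 u x := by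
  -- adapted from `curl_convect_self` (`VorticityStretching`)
  have hD : HasFDerivAt (fderiv ℝ u) (fderiv ℝ (fderiv ℝ u) x) x :=
    (((hu.fderiv_right (m := 1) (by norm_num)).differentiable one_ne_zero).differentiableAt).hasFDerivAt
  have hux : HasFDerivAt u (fderiv ℝ u x) x := ((hu.differentiable (by norm_num)) x).hasFDerivAt
  have hconv : HasFDerivAt (convect u u)
      ((fderiv ℝ u x).comp (fderiv ℝ u x) + (fderiv ℝ (fderiv ℝ u) x).flip (u x)) x := by
    have h := hD.clm_apply hux
    exact h
  have hsymm : (fderiv ℝ (fderiv ℝ u) x).flip (u x) = fderiv ℝ (fderiv ℝ u) x (u x) := by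
    ext k i
    rw [ContinuousLinearMap.flip_apply]
    exact congrFun (congrArg _ ((hu.contDiffAt.isSymmSndFDerivAt (by simp)) k (u x))) i
  rw [curl2_eq_curl2CLM, hconv.fderiv, map_add, curl2CLM_comp_self, hsymm]
  have h1 : curl2CLM (fderiv ℝ (fderiv ℝ u) x (u x)) = fderiv ℝ (curl2 u) x (u x) := by
    rw [fderiv_curl2 hu x, ContinuousLinearMap.comp_apply]
  have h3 : LinearMap.trace ℝ (EuclideanSpace ℝ (Fin 2))
      (fderiv ℝ u x : EuclideanSpace ℝ (Fin 2) →ₗ[ℝ] EuclideanSpace ℝ (Fin 2)) =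
      VectorCalculus.divergence u x := rfl
  rw [h1, h3, ← curl2_eq_curl2CLM]
  ring

/-- **`curl2 ∂ₜu = ∂ₜ curl2 u`** for a jointly smooth planar velocity on a time set of unique
differentiability (exchange of mixed partials,
`IsSmoothSpaceTimeOn.timeDerivWithin_fderiv_slice_apply_of_uniqueDiffOn`, followed by the linear
map `curl2CLM`; planar twin of the tree's `IsSmoothSpaceTimeOn.curl_timeDerivWithin`). [folklore] -/
private theorem curl2_timeDerivWithin {S : Set ℝ}
    {u : ℝ → EuclideanSpace ℝ (Fin 2) → EuclideanSpace ℝ (Fin 2)} (h : IsSmoothSpaceTimeOn S u)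
    (hS : UniqueDiffOn ℝ S) {t : ℝ} (ht : t ∈ S) (x : EuclideanSpace ℝ (Fin 2)) :
    curl2 (timeDerivWithin S u t) x = timeDerivWithin S (fun s y => curl2 (u s) y) t x := by
  -- adapted from `IsSmoothSpaceTimeOn.curl_timeDerivWithin` (`VorticityEquation`)
  have hop : timeDerivWithin S (fun s y => fderiv ℝ (u s) y) t x =
      fderiv ℝ (timeDerivWithin S u t) x := by
    ext a
    rw [← h.timeDerivWithin_fderiv_slice_apply_of_uniqueDiffOn hS ht x a, timeDerivWithin_apply,
      timeDerivWithin_apply,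
      derivWithin_clm_apply ((h.fderiv_slice hS).differentiableWithinAt_time ht x)
        (differentiableWithinAt_const _)]
    simp
  have hv : (fun s y => curl2 (u s) y) = fun s y => curl2CLM (fderiv ℝ (u s) y) := by
    funext s y; rfl
  rw [curl2_eq_curl2CLM, ← hop, hv, (h.fderiv_slice hS).timeDerivWithin_clm_comp hS curl2CLM ht x]

/-- In the plane, `curl2 w (z) = 0` is the symmetry of `Dw(z)`: `⟪Dw(z)a, b⟫ = ⟪Dw(z)b, a⟫` for
all `a, b` (`⟪Ta, b⟫ − ⟪Tb, a⟫ = (a₀b₁ − a₁b₀)((Te₀)₁ − (Te₁)₀)`). [folklore] -/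
private theorem inner_fderiv_comm_of_curl2_eq_zero
    {w : EuclideanSpace ℝ (Fin 2) → EuclideanSpace ℝ (Fin 2)} {z : EuclideanSpace ℝ (Fin 2)}
    (hw : curl2 w z = 0) (a b : EuclideanSpace ℝ (Fin 2)) :
    ⟪fderiv ℝ w z a, b⟫ = ⟪fderiv ℝ w z b, a⟫ := by
  set T := fderiv ℝ w z with hT
  have h0 : T (EuclideanSpace.single 0 1) 1 - T (EuclideanSpace.single 1 1) 0 = 0 := by
    rw [hT]; exact hw
  have ha : ∀ i, T a i = ∑ m, a m * T (EuclideanSpace.single m (1 : ℝ)) i := clm_apply_coord2 T a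
  have hb : ∀ i, T b i = ∑ m, b m * T (EuclideanSpace.single m (1 : ℝ)) i := clm_apply_coord2 T b
  simp only [PiLp.inner_apply, RCLike.inner_apply, conj_trivial, Fin.sum_univ_two, ha, hb]
  linear_combination (a 0 * b 1 - a 1 * b 0) * h0

end Curl2

/-! ### Step 4: the discharge -/

/-- **Giga–Miura 2011, Lemma 2.3 — the named fact `gigaMiura2011_planar_vorticity_liouville`
holds** (HUPS #956 p. 8 = CMP 303 §2.1: bounded smooth `(u, ω₃)` solving
`ω₃ₜ − Δω₃ + (u, ∇)ω₃ = 0` in `ℝ² × (−∞, 0)` with `curl u = ω`, `div u = 0` have `ω ≡ 0`).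
Proof along Remark 2.5 (ii) ("already proved in [KNSS]"): the momentum residual
`G = ∂ₜu + (u·∇)u − Δu` has `curl2 G = ∂ₜω + (u·∇)ω − Δω = 0` (`curl2_timeDerivWithin`,
`curl2_convect_self`, `curl2_laplacian`, `div u = 0`), hence annihilates the solenoidal tests
(`integral_inner_eq_zero_of_fderiv_symm_of_isDivFree`, Poincaré lemma); so `(u, 0, G)` is a
classical solution of the forced system whose force drops out of the weak formulation, `u` is a
bounded weak solution on `ℝ² × (−∞, 0)`
(`IsClassicalNSSolutionOn.isBoundedWeakNSSolutionOn_Iio_of_force_annihilates`), KNSS Thm 5.1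
(`KNSS2009_liouville_planar_holds`) makes every slice spatially constant (a.e., then everywhere
by continuity), and `ω = curl2 u = 0`. [cite: GigaMiura2011, Lemma 2.3 and Remark 2.5 (ii) (§2.1; HUPS preprint #956 p. 8)] -/
theorem gigaMiura2011_planar_vorticity_liouville_holds :
    gigaMiura2011_planar_vorticity_liouville := by
  intro u ζ hu hζ hbd hvort hcurl hdiv
  have hS : UniqueDiffOn ℝ (Iio (0 : ℝ)) := isOpen_Iio.uniqueDiffOn
  have hsm : IsSmoothSpaceTimeOn (Iio 0) u := hu
  obtain ⟨K, hK⟩ := hbd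
  have hbdd : IsBoundedOn (Iio 0) u := ⟨K, fun t ht x => (hK t ht x).1⟩
  have hcont : ContinuousOn (uncurry u) (Iio 0 ×ˢ univ) := hu.continuousOn
  -- the momentum residual `G = ∂ₜu + (u·∇)u − Δu` as a force, with zero pressure
  set G : ℝ → EuclideanSpace ℝ (Fin 2) → EuclideanSpace ℝ (Fin 2) := fun t x =>
    timeDerivWithin (Iio 0) u t x + convect (u t) (u t) x - (Δ (u t)) x with hG
  have hcl : IsClassicalNSSolutionOn (Iio 0) 1 G u (fun _ _ => (0 : ℝ)) := by
    refine ⟨hsm, contDiffOn_const, fun t ht x => ?_, fun t ht => hdiv t ht⟩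
    simp only [hG, one_smul, gradient_fun_const, sub_zero]
    abel
  -- Step 1: `curl2 G = 0`
  have hcurlG : ∀ t < 0, ∀ x, curl2 (G t) x = 0 := by
    intro t ht x
    have hut : ContDiff ℝ ∞ (u t) := hsm.contDiff_slice ht
    have hu2 : ContDiff ℝ 2 (u t) := contDiff_infty.1 hut 2
    have hu3 : ContDiff ℝ 3 (u t) := contDiff_infty.1 hut 3
    have hT : ContDiff ℝ ∞ (timeDerivWithin (Iio 0) u t) := (hsm.timeDerivWithin hS).contDiff_slice ht
    have hC : ContDiff ℝ ∞ (convect (u t) (u t)) := (hsm.convect hsm hS).contDiff_slice ht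
    have hL : ContDiff ℝ ∞ (Δ (u t)) := (hsm.laplacian hS).contDiff_slice ht
    have hTd : DifferentiableAt ℝ (timeDerivWithin (Iio 0) u t) x := (hT.differentiable (by simp)) x
    have hCd : DifferentiableAt ℝ (convect (u t) (u t)) x := (hC.differentiable (by simp)) x
    have hLd : DifferentiableAt ℝ (Δ (u t)) x := (hL.differentiable (by simp)) x
    have hTCd : DifferentiableAt ℝ
        (fun y => timeDerivWithin (Iio 0) u t y + convect (u t) (u t) y) x := hTd.add hCd
    -- linearity of `curl2` at `x`
    have hsplit : curl2 (G t) x = curl2 (timeDerivWithin (Iio 0) u t) x +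
        curl2 (convect (u t) (u t)) x - curl2 (Δ (u t)) x := by
      simp only [curl2_eq_curl2CLM, hG]
      rw [fderiv_fun_sub hTCd hLd, fderiv_fun_add hTd hCd, map_sub, map_add]
    -- `curl2 ∂ₜu = ∂ₜ ω`
    have h1 : curl2 (timeDerivWithin (Iio 0) u t) x = deriv (fun τ => ζ τ x) t := by
      rw [curl2_timeDerivWithin hsm hS ht x, timeDerivWithin_apply,
        derivWithin_congr (f := fun s => ζ s x) (fun s hs => by
          show curl2 (u s) x = ζ s x; rw [hcurl s hs]) (by show curl2 (u t) x = ζ t x; rw [hcurl t ht]),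
        derivWithin_of_isOpen isOpen_Iio ht]
    -- `curl2 ((u·∇)u) = (u·∇)ω` (no stretching, `div u = 0`)
    have h2 : curl2 (convect (u t) (u t)) x = fderiv ℝ (ζ t) x (u t x) := by
      rw [curl2_convect_self hu2 x, hdiv t ht x, zero_mul, add_zero, hcurl t ht]
    -- `curl2 Δu = Δω`
    have h3 : curl2 (Δ (u t)) x = (Δ (ζ t)) x := by
      rw [curl2_laplacian hu3 x, hcurl t ht]
    rw [hsplit, h1, h2, h3]
    linarith [hvort t ht x]
  -- Step 2: the force annihilates the solenoidal tests
  have hGann : ∀ t < 0, ∀ φ : EuclideanSpace ℝ (Fin 2) → EuclideanSpace ℝ (Fin 2),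
      ContDiff ℝ (⊤ : ℕ∞) φ → HasCompactSupport φ → VectorCalculus.IsDivFree φ →
      ∫ x, ⟪G t x, φ x⟫ = 0 := by
    intro t ht φ hφ hφc hφdiv
    have hGs : ContDiff ℝ ∞ (G t) := (hcl.isSmoothSpaceTimeOn_force hS).contDiff_slice ht
    have hsym : ∀ z v w : EuclideanSpace ℝ (Fin 2),
        ⟪fderiv ℝ (G t) z v, w⟫ = ⟪fderiv ℝ (G t) z w, v⟫ := fun z v w =>
      inner_fderiv_comm_of_curl2_eq_zero (hcurlG t ht z) v w
    exact integral_inner_eq_zero_of_fderiv_symm_of_isDivFree (contDiff_infty.1 hGs 1) hsym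
      (contDiff_infty.1 hφ 1) hφc hφdiv
  -- Step 3: `u` is a bounded weak solution on `ℝ² × (−∞, 0)`
  have hweak : IsBoundedWeakNSSolutionOn (Iio 0) isOpen_Iio 1 u :=
    hcl.isBoundedWeakNSSolutionOn_Iio_of_force_annihilates hbdd hGann
  -- Step 4: KNSS Theorem 5.1, and continuity
  obtain ⟨b, -, -, hae⟩ := KNSS2009_liouville_planar_holds hweak
  have huc : ∀ t < 0, Continuous (u t) := fun t ht =>
    hcont.comp_continuous (f := fun x : EuclideanSpace ℝ (Fin 2) => (t, x)) (by fun_prop)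
      fun x => ⟨ht, mem_univ _⟩
  have htr : ∀ x : EuclideanSpace ℝ (Fin 2), ContinuousOn (fun t => u t x) (Iio 0) := fun x =>
    hcont.comp (f := fun t : ℝ => (t, x)) (by fun_prop) fun t ht => ⟨ht, mem_univ _⟩
  have hae' : ∀ᵐ t ∂(volume.restrict (Iio (0 : ℝ))), ∀ x, u t x = u t 0 := by
    filter_upwards [hae, ae_restrict_mem measurableSet_Iio] with t ht ht0 x
    have h := Measure.eq_of_ae_eq ht (huc t ht0) continuous_const
    rw [congrFun h x, congrFun h 0]
  have hconst : ∀ t < 0, ∀ x, u t x = u t 0 := by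
    intro t ht x
    have hx : ∀ᵐ τ ∂(volume.restrict (Iio (0 : ℝ))), (fun τ => u τ x) τ = (fun τ => u τ 0) τ := by
      filter_upwards [hae'] with τ hτ using hτ x
    exact Measure.eqOn_open_of_ae_eq hx isOpen_Iio (htr x) (htr 0) ht
  -- `ω = curl2 u = 0`
  intro t ht x
  have hfun : u t = fun _ => u t 0 := funext (hconst t ht)
  rw [← hcurl t ht, hfun, curl2_const]
  rfl

end Literature.Analysis.FluidPDE

end
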